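/-
Origin: expansion seat `planner-pub-hodgecm-pv14-0`, handover 2026-08-18T04:05:44Z (`HOME/pub-hodgecm-pv14/lean/Pv14/PerL34/P43FrameBall.lean`, md5 ba6d8122, 59 lines);
landed by the gen-5 packager in gate run 21 as `HodgeCM/PerL34/P43_frameBall.lean` (import ^import Pv14\.PerL34\.P43Frame\b→import HodgeCM.PerL34.P43_frame ×1).
-/
/-
Origin: HOME/pub-hodgecm-pv14/lean/Pv14/PerL34/P43FrameBall.lean — session planner-pub-hodgecm-pv14-0 (unit pub-hodgecm-pv14).
Intended final place: `HodgeCM/PerL34/P43_frameBall.lean`, after `HodgeCM/PerL34/Ball.lean` (pv03) and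
`HodgeCM/PerL34/P43_frame.lean` (pv14, handed over 04:05Z; here `import Pv14.PerL34.P43Frame` — PACKAGER: rewrite to
the landed name).  KERNEL: the cocycle identity of pv03's cotangent cocycle `BallModel.A` on `𝔹²` from the chain
rule for the Jacobians (pv03's `Jac_mul`, file `BallCocycle.lean`, taken here as the hypothesis `ChainRule` so that
this file depends only on the landed `Ball.lean`), i.e. residual (a) of LEMMAS v3 §8 FRONTIER item (iv) after
`P43_frame.lean`.
-/
import Summits.HodgeConjecture.HodgeCM.PerL34.Ball_2
import Summits.HodgeConjecture.HodgeCM.PerL34.P43_frame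

/-! PORT of `HodgeCM/PerL34/P43_frameBall.lean` (HodgeCMPerL run 82) — verbatim mechanical port; provenance in the PORT header line. -/

set_option autoImplicit false

namespace HodgeCM
namespace PerL34
namespace P43FrameBall

open Matrix BallModel

/-- The chain rule for the Jacobian matrices of the action of `U(2,1)` on `𝔹²` — pv03's `BallModel.Jac_mul`
(`BallCocycle.lean`), by name once that file lands. -/
def ChainRule : Prop := ∀ (g h : U21) (z : Ball), Jac (g * h) z = Jac g (h • z) * Jac h z

/-- `coT g z = ((Jac g z)ᵀ)⁻¹`. -/
theorem coT_eq_inv (g : U21) (z : Ball) : coT g z = ((Jac g z)ᵀ)⁻¹ :=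
  (Matrix.inv_eq_left_inv (coT_mul_transpose_Jac g z)).symm

/-- The cotangent cocycle identity `coT (g h) z = coT g (h • z) * coT h z` from the chain rule. -/
theorem coT_mul (hC : ChainRule) (g h : U21) (z : Ball) : coT (g * h) z = coT g (h • z) * coT h z := by
  rw [coT_eq_inv, coT_eq_inv, coT_eq_inv, hC, Matrix.transpose_mul, Matrix.mul_inv_rev]

/-- **`BallModel.A` is a cocycle** in the sense of `P43Frame.Cocycle` (for the underlying linear maps). -/
theorem cocycle_A (hC : ChainRule) :
    P43Frame.Cocycle (fun (g : U21) (z : Ball) => ((A g z : (Fin 2 → ℂ) →L[ℂ] (Fin 2 → ℂ)) :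
      (Fin 2 → ℂ) →ₗ[ℂ] (Fin 2 → ℂ))) := by
  intro g h z w
  simp only [ContinuousLinearMap.coe_coe, A_apply]
  rw [coT_mul hC, Matrix.mulVec_mulVec]

/-- The continuous-linear form of the identity (the hypothesis `hA` of `P43Frame.stableUnder_comap`). -/
theorem cocycle_A' (hC : ChainRule) (g h : U21) (z : Ball) (w : Fin 2 → ℂ) :
    A (g * h) z w = A g (h • z) (A h z w) := by
  simpa using cocycle_A hC g h z w

/-- **FRONTIER (iv) at the ball level, assembled**: for pv03's ball model and ANY left-translation-stable space
`𝒱` of `ℂ²`-valued functions on `U(2,1)` (e.g. the frame readings of pv02's `𝒰_i`, stable by pv02's KERNEL N33c),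
the space of one-forms `R⁻¹ 𝒱` on `𝔹²` is `Δ`-stable in pv03's literal sense `WedgeNonvanishing.StableUnder`. -/
theorem stableUnder_ball (hC : ChainRule) (Δ : Subgroup U21) (𝒱 : Submodule ℂ (U21 → (Fin 2 → ℂ)))
    (h𝒱 : ∀ γ ∈ Δ, ∀ φ ∈ 𝒱, P43.lTransl γ φ ∈ 𝒱) :
    WedgeNonvanishing.StableUnder Δ A
      (𝒱.comap (P43Frame.frameRead
        (fun (g : U21) (z : Ball) => ((A g z : (Fin 2 → ℂ) →L[ℂ] (Fin 2 → ℂ)) : (Fin 2 → ℂ) →ₗ[ℂ] (Fin 2 → ℂ)))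
        x₀)) :=
  P43Frame.stableUnder_comap A x₀ (cocycle_A' hC) Δ 𝒱 h𝒱

end P43FrameBall
end PerL34
end HodgeCM
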